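import Summits.BirchSwinnertonDyer.BirchSwinnertonDyer.Theorems.EisensteinPrimesGoodLatticeBDPValueOfNamedFactsV24
import Summits.BirchSwinnertonDyer.BirchSwinnertonDyer.Theorems.EisensteinPrimesGoodLatticeBDPValueOfKatzUnit
import Summits.BirchSwinnertonDyer.BirchSwinnertonDyer.Theorems.EisensteinPrimesGoodLatticeBDPValueKatzUnitSuppliers
import HarnessLib
/-!
# Crux `GoodLatticeBDPValue` (stmt-BirchSwinnertonDyer-19032), line `halves`: THE CRUX BY NAME FROM TWELVE LITERATURE NAMED FACTS
# — the v24 surface with stub 1 cut to FOUR (Hida's Theorem I not cited by name): the closure for the LEAD's announced v25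
# (width seat `bsd-line-x1-p1-w5` gen 5; `--supports stmt-BirchSwinnertonDyer-19032`; W-79: the reshape is the LEAD's)

On halves v24 (LEAD g7, p667350) the crux BY NAME is conditional on THIRTEEN Literature named facts. The fifth conjunct of stub 1,
`Hida2010MuInvariant.thmI_mu_katzBranch_reflect_eq_zero` (Hida 2010 Thm. I in a second, de-Shalit-frame currency), does one thing on
the line — `g(S=0) mod p ≠ 0` for Rubin's `ℤ_p`-form (§5 of the joint [BR𝟙]/[BRω] theorem) — and the width seat's chain p665992
(reversed `μ`-transfer) → p666612 (the joint theorem on an `R₀` Katz witness with a unit coefficient) → p667992 / `…OfKatzUnit`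
(road / terminal consumer) → p667318 (suppliers) shows that this `μ`-input is ALREADY inside the antecedent: it is the `μ`-clause of
[AN] `thm222_anacong_goodLattice_OPEN`, which the line derives from `…_of_fullDescentDatum` (3a-A by name) and `…_of_five_le`
(«CGLS 2.2.1/2.2.2 ∘ Kriz ∘ Hida 2010», composed print). LEAD g7 (STATUS 21:02:41Z): «when #4/#5 and the V25 closure are ACCEPTED,
I RESHAPE v24 → v25 = stub 1: 5 → 4».

Results (sorry-free, CONDITIONAL on the hypotheses they name):
* `imprimLambdaLE_of_facts` — v23's [ALG-imp-λ] glue with the stub bundles unpacked into the eleven facts it uses;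
* `goodLatticeBDPValue_of_namedFacts₂₅ : ⟨proofThm422 ∧ thm513_disc ∧ thm331 ∧ thmII64⟩ → thm222_anacong_goodLattice_of_fullDescentDatum
  → ⟨prop411 ∧ cycWL ∧ (∀ L, tateGlobalEulerPoincareCharacteristic L) ∧ (∀ L, poitouTate_restricted_three_le L)⟩ →
  ⟨prop263 ∧ _of_five_le ∧ thm212⟩ → Theses.EisensteinPrimes.GoodLatticeBDPValue` — TWELVE Literature named facts, 0 inline
  statements.

HONEST FRAMING: CONDITIONAL theorems (audit `proof.conditional`); they close nothing; no summit statement / BSD / KY Thm. 1.4.1 /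
2.2.2 / the crux is proved here; 0 cells / labels move; the registered skeleton v24 is untouched by this seat.
References: those of p664468, p667350 and of the files named.
-/

-- `Summit.BirchSwinnertonDyer.BirchSwinnertonDyer.…`: the summit and its single sub-problem share a name (D-0017 layout).
set_option linter.dupNamespace false
set_option autoImplicit false

namespace Summit.BirchSwinnertonDyer.BirchSwinnertonDyer.Theorems.GoodLatticeBDPValueOfNamedFactsV25

open scoped Classical

open PowerSeries
  WeierstrassCurve
  NumberField
  IsDedekindDomain
  Field
  Literature.NumberTheory.GaloisRepresentations
  Literature.NumberTheory.EllipticCurves.GreenbergVatsal2000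
  Summit.BirchSwinnertonDyer.BirchSwinnertonDyer.Theorems.EisensteinPrimesMuLambda
  Literature.NumberTheory.EllipticCurves
  Literature.NumberTheory.EllipticCurves.ModularForms
  Literature.NumberTheory.EllipticCurves.Rank1Residual
  Literature.NumberTheory.EllipticCurves.Castella2018
  Literature.NumberTheory.EllipticCurves.GreenbergSelmer
  Literature.NumberTheory.QuadraticFields
  Literature.NumberTheory.EllipticCurves.CastellaGrossiLeeSkinner2022
  Literature.NumberTheory.EllipticCurves.KellerYin2024
  Literature.NumberTheory.EllipticCurves.IwasawaAlgebra
  Literature.NumberTheory.EllipticCurves.Rubin1991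
  Literature.NumberTheory.EllipticCurves.DeShalit1987
  Literature.NumberTheory.EllipticCurves.Hida2010MuInvariant
  Literature.NumberTheory.EllipticCurves.BCGKPST2020
  Literature.NumberTheory.IwasawaTheory
  Literature.NumberTheory.IwasawaTheory.Greenberg2016
  Literature.NumberTheory.IwasawaTheory.Greenberg2006
  Summit.BirchSwinnertonDyer.BirchSwinnertonDyer.Theorems
  Summit.BirchSwinnertonDyer.Rank1Residual.X1.KellerYinHalves
  Summit.BirchSwinnertonDyer.Rank1Residual.X2.ResidualDevissageModules
  Summit.BirchSwinnertonDyer.Rank1Residual.X1.KellerYinMuLambdaSplitDSFree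
  Summit.BirchSwinnertonDyer.BirchSwinnertonDyer.Theorems.GoodLatticeBDPValueHalves
  Summit.BirchSwinnertonDyer.BirchSwinnertonDyer.Theorems.GoodLatticeBDPValueOfImprimitive
  Summit.BirchSwinnertonDyer.BirchSwinnertonDyer.Theorems.GoodLatticeBDPValueOfOneInequality
  Summit.BirchSwinnertonDyer.BirchSwinnertonDyer.Theorems.GoodLatticeImprimitiveOfQuotient
  Summit.BirchSwinnertonDyer.BirchSwinnertonDyer.Theorems.GoodLatticeQuotientOfCorank
  Summit.BirchSwinnertonDyer.BirchSwinnertonDyer.Theorems.GoodLatticeCorankOfGe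
  Summit.BirchSwinnertonDyer.BirchSwinnertonDyer.Theorems.GoodLatticeBDPValueOfNamedFactsV23

/-! ### [ALG-imp-λ] glue with the facts by name -/
/-- **[ALG-imp-λ] in cotorsion `≤` form, from the eleven Greenberg-type / duality facts BY NAME** — LEAD g6's
`GoodLatticeBDPValueOfNamedFactsV23.imprimLambdaLE_of_index` (p664468) with the stub bundles unpacked: hypotheses are
Greenberg 2016 Prop. 2.6.3, the two textbook duality facts (Milne ADT I 5.1, Harari 17.13 (a), at every number field), and the
eight Greenberg-type conjuncts of v22's stub 4 (Props. 4.1.1 / 4.2.2 / §5 A / 4.1 / 4.2 / 3.2, Bleher et al. §3.3, T4); proof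
byte-identical otherwise (inputs `indexInputs_of_textbook`, mid-level `zpCorank_datumStrictSelmer_add_eq`, plumbing
`IndexPlumbingNrVsStrict.stub_indexPlumbing`) — so that a composition whose stub 1 no longer has five conjuncts can call it.
[cite: KellerYin2024, Thm. 1.4.1 (iii)] [cite: Greenberg2016Selmer, Prop. 2.6.3, Prop. 4.1.1] [cite: Greenberg2006, §5 A, Props. 3.2, 4.1, 4.2] -/
theorem imprimLambdaLE_of_facts
    (h263 : prop263_sur_of_crk)
    (hEPC : ∀ (L : Type) [Field L] [NumberField L], Literature.NumberTheory.GaloisCohomology.tateGlobalEulerPoincareCharacteristic L)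
    (hPT3 : ∀ (L : Type) [Field L] [NumberField L], Literature.NumberTheory.GaloisCohomology.poitouTate_restricted_three_le L)
    (h411 : prop411_selmer_isAlmostDivisible)
    (h422 : prop422_localCohomology_isAlmostDivisible) (h5A : sec5A_localH2_subsingleton_of_LOC1)
    (h41 : prop41_globalEulerPoincareCorank) (h42 : prop42_localEulerPoincareCorank)
    (h32 : prop32_cohomology_isCofinitelyGenerated)
    (h33 : BCGKPST2020.sec33_rubin_unrSelmer₂_finite_torsion)
    (hT4 : weakLeopoldt_H2_subsingleton_above_cyclotomic_of_isOpen) :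
    ∀ (W : WeierstrassCurve ℚ) [W.IsElliptic] [W.IsGloballyMinimal] (p : ℕ) [Fact p.Prime],
      2 < p → Good W p → Red W p → Anom W p →
      (∀ Φ : AddSubgroup (geomTorsion W (p : ℤ)), IsRationalLine W p Φ → ¬ LineUnramifiedAt W p Φ) →
      ∀ (K : Type) [Field K] [NumberField K], IsImaginaryQuadratic K →
        SatisfiesHeegnerHypothesis (W.conductorNorm ℤ) K → SatisfiesHeegnerHypothesis p K →
        (∀ Q : (W.baseChange K).toAffine.Point, p • Q = 0 → Q = 0) →
      ∀ (ι : K →+* ℚ_[p]) (v vbar : HeightOneSpectrum (𝓞 K)),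
        (∀ x : 𝓞 K, x ∈ v.asIdeal ↔ ‖ι (x : K)‖ < 1) →
        ((p : ℕ) : 𝓞 K) ∈ vbar.asIdeal → vbar ≠ v →
      ∀ (κ : ZpExtension K p), κ.IsAnticyclotomic →
      ∀ (γ : absoluteGaloisGroup K) [Fact (κ.IsTopGenerator γ)],
      ∀ (θsub θquot : FramedGaloisRep K (padicCoeffIntegers (∅ : Set (PadicAlgCl p))) 1),
        IsResidualPairOver (W.baseChange K) p θsub θquot →
      ∀ (Sf : Finset (HeightOneSpectrum (𝓞 K))),
        (∀ w : HeightOneSpectrum (𝓞 K), w ∈ Sf ↔ ((W.conductorNorm ℤ : ℤ) : 𝓞 K) ∈ w.asIdeal) →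
      ∀ (DSsub : DatumDualData κ γ (charModule ∅ θsub)
          (AcSelmer.bdpData (charModule ∅ θsub) p vbar) (↑Sf : Set (HeightOneSpectrum (𝓞 K))))
        (DSquot : DatumDualData κ γ (charModule ∅ θquot)
          (AcSelmer.bdpData (charModule ∅ θquot) p vbar) (↑Sf : Set (HeightOneSpectrum (𝓞 K)))),
      Module.Finite (IwasawaAlgebra p) (AcSelmer.XAc (W.baseChange K) p κ vbar (↑Sf : Set (HeightOneSpectrum (𝓞 K))) γ) →
      Module.IsTorsion (IwasawaAlgebra p) (AcSelmer.XAc (W.baseChange K) p κ vbar (↑Sf : Set (HeightOneSpectrum (𝓞 K))) γ) →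
      muInvariant p (AcSelmer.XAc (W.baseChange K) p κ vbar (↑Sf : Set (HeightOneSpectrum (𝓞 K))) γ) = 0 →
      (∀ D : DatumDualData κ γ (charModule ∅ θsub)
          (AcSelmer.bdpData (charModule ∅ θsub) p vbar) (↑Sf : Set (HeightOneSpectrum (𝓞 K))),
        Module.Finite (IwasawaAlgebra p) D.X ∧ Module.IsTorsion (IwasawaAlgebra p) D.X ∧ muInvariant p D.X = 0) →
      (∀ D : DatumDualData κ γ (charModule ∅ θquot)
          (AcSelmer.bdpData (charModule ∅ θquot) p vbar) (↑Sf : Set (HeightOneSpectrum (𝓞 K))),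
        Module.Finite (IwasawaAlgebra p) D.X ∧ Module.IsTorsion (IwasawaAlgebra p) D.X ∧ muInvariant p D.X = 0) →
      lambdaInvariant p DSsub.X + lambdaInvariant p DSquot.X ≤
        lambdaInvariant p (AcSelmer.XAc (W.baseChange K) p κ vbar (↑Sf : Set (HeightOneSpectrum (𝓞 K))) γ) +
          (if ∀ σ : absoluteGaloisGroup K, θquot σ = 1 then 1 else 0) := by
  intro W _ _ p _ hp hgood hred hanom hlat K _ _ hK hH hHp htor ι v vbar hv hvbar hne κ hκ γ _ θsub θquot hpair Sf hSf
    DSsub DSquot hfgS htorS hμS hSsub hSquot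
  obtain ⟨c, τ, Φ, j₁, j₃, hj₁, hj₃, hτ, hdist, hreps₁, hreps₂, hreps₃, hj₁inj, hj₃inj, hr₁, hr₃, hr₂, hd₂, hUi, hU₁, hU₂,
    hU₃, hsur₁, hsur₂, hsur₃, hprim₁, hprim₂, hprim₃, hfin₁, hfin₂, hfin₃, hinv₁, hinv₂, hinv₃, hN₂, hfinq, hε, hN₁D,
    htrivD, hfinQ, hN₃, hinvD₁, hinvD₃, hH2⟩ :=
    GoodLatticeBDPValuePublishedFactsOfTextbook.indexInputs_of_textbook h263 hEPC hPT3
      W p hp hgood hred hanom hlat K hK hH hHp htor ι v vbar hv hvbar hne κ hκ γ θsub θquot hpair Sf hSf hfgS htorS hμS hSsub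
      hSquot
  haveI := hfin₁; haveI := hfin₂; haveI := hfin₃; haveI := hfinq; haveI := hfinQ
  haveI hEK : (W.baseChange K).IsElliptic := inferInstanceAs (W.map (algebraMap ℚ K)).IsElliptic
  have hcN₂ : ∀ b : ↥((W.baseChange K).geomTorsion (p : ℤ)), Continuous fun σ : absoluteGaloisGroup K ↦ σ • b :=
    fun b ↦ continuous_of_injective_comp (G := absoluteGaloisGroup K) Subtype.val_injective
      ((W.baseChange K).continuous_smul_geomPoints (b : geomPoints (W.baseChange K)))
  -- DIV ×3 and LRS: `cd_p(ker κ ⊓ D_v̄) ≤ 1` (w4 gen 3, `AnticyclotomicLocalCdOne`)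
  have hneD : ∃ τ ∈ decomp (K := K) vbar, κ τ ≠ 1 :=
    AnticyclotomicLocalCdOne.exists_mem_decomp_apply_ne_one_of_isAnticyclotomic κ vbar hK hp.ne' hκ hvbar
  have hdiv₁ : ∀ y : subgroupH1 (κ.kerSubgroup ⊓ decomp vbar) (charModule ∅ θsub), ∃ y', p • y' = y := fun y ↦ by
    obtain ⟨y', hy'⟩ := AnticyclotomicLocalCdOne.exists_eq_nsmul_subgroupH1_inf_decomp κ vbar hneD
      (CharResidualSelmerCount.continuous_smul_charModule θsub) (CharResidualSelmerCount.charModule_divisible θsub) y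
    exact ⟨y', hy'.symm⟩
  have hdiv₂ : ∀ y : subgroupH1 (κ.kerSubgroup ⊓ decomp vbar) ↥((W.baseChange K).geomPrimaryTorsion p),
      ∃ y', p • y' = y := fun y ↦ by
    obtain ⟨y', hy'⟩ := AnticyclotomicLocalCdOne.exists_eq_nsmul_subgroupH1_inf_decomp κ vbar hneD
      ((W.baseChange K).continuous_smul_geomPrimaryTorsion p) hd₂ y
    exact ⟨y', hy'.symm⟩
  have hdiv₃ : ∀ y : subgroupH1 (κ.kerSubgroup ⊓ decomp vbar) (charModule ∅ θquot), ∃ y', p • y' = y := fun y ↦ by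
    obtain ⟨y', hy'⟩ := AnticyclotomicLocalCdOne.exists_eq_nsmul_subgroupH1_inf_decomp κ vbar hneD
      (CharResidualSelmerCount.continuous_smul_charModule θquot) (CharResidualSelmerCount.charModule_divisible θquot) y
    exact ⟨y', hy'.symm⟩
  have hpQ : ∀ Q : ↥((W.baseChange K).geomTorsion (p : ℤ)), p • Q = 0 := fun Q ↦ by
    apply Subtype.ext
    have h := (mem_geomTorsion_iff (W.baseChange K) (p : ℤ) (Q : geomPoints (W.baseChange K))).mp Q.2
    rw [AddSubmonoidClass.coe_nsmul, ← natCast_zsmul, h]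
    rfl
  have hlrs := AnticyclotomicLocalCdOne.resH1Hom_id_surjective_inf_decomp κ vbar hneD
    (fun a ↦ Φ.continuous_smul_sub hcN₂ a) hcN₂ (fun a ↦ Φ.continuous_smul_quot hcN₂ a)
    (fun n ↦ ⟨1, Φ.incl_injective (by rw [map_nsmul, map_zero, pow_one]; exact hpQ _)⟩)
    Φ.incl Φ.incl_smul Φ.incl_injective Φ.proj Φ.proj_smul Φ.proj_incl
    (fun b hb ↦ Φ.mem_range_incl_of_proj_eq_zero b hb) Φ.proj_surjective
  -- FIN: `E(K_{∞,w̄})[p^∞]` is finite (w2 gen 3, `AnomalousLocalTorsion`)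
  haveI hfinED : Finite {x : ↥((W.baseChange K).geomPrimaryTorsion p) // ∀ g : ↥(κ.kerSubgroup ⊓ decomp vbar), g • x = x} := by
    have hF := AnomalousLocalTorsion.localTowerTorsionFiniteAt_of_isAnticyclotomic W hp.ne' hanom hlat hK
      (IwasawaTwoVariable.natCast_mem_asIdeal_of_norm_iff hv) hvbar hne κ hκ
    haveI := hF.to_subtype
    refine Finite.of_injective (fun x ↦ (⟨x.1, (FixedPoints.mem_addSubgroup _ _ _).mpr fun g ↦
      x.2 ⟨g.1, by rw [inf_comm]; exact g.2⟩⟩ :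
        (FixedPoints.addSubgroup ↥(decomp (K := K) vbar ⊓ κ.kerSubgroup) ↥((W.baseChange K).geomPrimaryTorsion p) :
          Set ↥((W.baseChange K).geomPrimaryTorsion p)))) fun a b h ↦ Subtype.ext ?_
    simpa using congrArg Subtype.val h
  have hmid := ResidualIndexAssembly.zpCorank_datumStrictSelmer_add_eq κ.kerSubgroup p
    (↑Sf : Set (HeightOneSpectrum (𝓞 K))) vbar hvbar Φ.incl Φ.proj Φ.incl_smul Φ.proj_smul Φ.incl_injective
    Φ.proj_surjective (fun b hb ↦ Φ.mem_range_incl_of_proj_eq_zero b hb) Φ.proj_incl j₁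
    (AddSubgroup.inclusion (geomTorsion_le_geomPrimaryTorsion (W.baseChange K) p)) j₃ hj₁ (fun _ _ ↦ rfl) hj₃ hj₁inj
    (AddSubgroup.inclusion_injective _) hj₃inj hr₁ hr₂ hr₃ (CharResidualSelmerCount.charModule_divisible θsub) hd₂
    (CharResidualSelmerCount.charModule_divisible θquot) (fun a ↦ Φ.continuous_smul_sub hcN₂ a) hcN₂
    (fun a ↦ Φ.continuous_smul_quot hcN₂ a) (CharResidualSelmerCount.continuous_smul_charModule θsub)
    ((W.baseChange K).continuous_smul_geomPrimaryTorsion p) (CharResidualSelmerCount.continuous_smul_charModule θquot)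
    hUi hU₁ hU₂ hU₃ c τ hreps₁ hreps₂ hreps₃ hsur₁ hsur₂ hsur₃ hdiv₁ hdiv₂ hdiv₃ hlrs hprim₁ hprim₂ hprim₃ hinv₁ hinv₂ hinv₃
    hN₂ hε hN₁D htrivD hN₃ hinvD₁ hinvD₃ hH2
  exact IndexPlumbingNrVsStrict.stub_indexPlumbing h411 h422 h5A h41 h42 h32 h33 hT4 h263 W p hp hgood hred hanom hlat K hK hH
    hHp htor ι v vbar hv hvbar hne κ hκ γ θsub θquot hpair Sf hSf DSsub DSquot c τ hτ hdist hreps₁ hreps₂ hreps₃ hsur₁ hsur₃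
    hmid hfgS htorS hμS hSsub hSquot

/-! ### The crux BY NAME from twelve Literature named facts -/
/-- **THE CRUX BY NAME — `Theses.EisensteinPrimes.GoodLatticeBDPValue` — from TWELVE LITERATURE NAMED FACTS (the v24 surface
with stub 1 CUT TO FOUR: Hida's Theorem I no longer cited by name).** Hypotheses = LEAD g7's
`GoodLatticeBDPValueOfNamedFactsV24.goodLatticeBDPValue_of_namedFacts₂₄` (p667350) token for token EXCEPT that
`stub_publishedFacts` has four conjuncts (`thmI_mu_katzBranch_reflect_eq_zero` GONE). Composition: (T4) from cycWL
(`above_cyclotomic_of_cyclotomic`, p665558); v22's eight Greenberg-type facts (`publishedFactsGreenberg_of_textbook`, p660402, with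
BCGKPST §3.3 from Thm. 3.3.1, p661944); [AN] `han : thm222_anacong_goodLattice_OPEN` from 3a-A BY NAME and `_of_five_le`
(p660970); then the width seat's terminal consumer `GoodLatticeBDPValueOfKatzUnit.goodLatticeBDPValue_of_print_of_leTD_of_le_of_anQ_of_katzUnit`
with its `μ`-input SUPPLIED FROM INSIDE THE ANTECEDENT, `GoodLatticeBDPValueKatzUnitSuppliers.katzUnitAll_of_anacong han ⟨thm212⟩`
(p667318); [ALG-imp-λ] via `imprimLambdaLE_of_facts`, the prop125 chain, `FSideCorankLe.stub_fSideCorankLe` and the ℚ-currency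
[AN] glue `anQ_of_thm222_OPEN` as in v23/v24. WHY HONEST: `…_of_five_le` is «CGLS 2.2.1/2.2.2 ∘ Kriz ∘ Hida 2010» and
`…_of_fullDescentDatum` likewise composes Hida Thm. I (their docstrings); their conclusions carry `FirstUnitCoeffAt Lφ nφ`, which the
reversed `μ`-transfer (p665992) turns into the one thing the de-Shalit-frame currency was used for. CONDITIONAL on exactly these
twelve names (research 7: CGLS 2022 proof of Thm. 4.2.2, Thm. 5.1.3 (disc), Thm. 2.1.2; Bleher et al. 2020 Thm. 3.3.1; de Shalit
1987 II.6.4; Greenberg 2016 Props. 4.1.1, 2.6.3; composed-print 2: `_of_five_le`, `_of_fullDescentDatum`; textbook 3: NSW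
(10.3.25) cycWL, Milne ADT I 5.1, Harari 17.13 (a)); closes nothing by itself; the v25 reshape is the LEAD's call (W-79); BSD is
proved for no curve. [claim: KellerYin2024, status: under-review]
[cite: KellerYin2024, Thm. 3.0.8 (IMC2) and proof (arXiv:2402.12781v2 TeX L1631–1640), Thm. 1.4.1, proof of Thm. 1.5.1, Thms. 2.2.1–2.2.3]
[cite: CastellaGrossiLeeSkinner2022, proof of Thm. 4.2.2, Thm. 5.1.3 with (disc), Thm. 2.1.2, Thms. 2.2.1/2.2.2 with (2.16), proof of Thm. 1.5.1, Prop. 1.2.5]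
[cite: Kriz2016, Thm. 3, Def. 31 (5), Rem. 33, Thm. 34 (3), Thm. 35] [cite: BleherEtAl2020, §3.3 Thm. 3.3.1] [cite: deShalit1987, II.6.4 Theorem (i)]
[cite: Hida2010MuInvariant, Thm. I (inside the composed [AN] facts; not a hypothesis here)]
[cite: Greenberg2016Selmer, Prop. 4.1.1, Prop. 2.6.3] [cite: NeukirchSchmidtWingberg2008, (10.3.25) with (10.3.22)]
[cite: MilneADT2006, I Thm. 5.1] [cite: Harari2020, Thm. 17.13 (a)] [cite: PollackWeston2011, App. A Prop. A.2] -/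
theorem goodLatticeBDPValue_of_namedFacts₂₅
    (stub_publishedFacts :
      proofThm422_exists_isBDPLFunction_isTorsion_charIdeal_dvd ∧
        thm513_exists_isBDPLFunction_valueAtOne_disc ∧
        thm331_rubin_exists_katzMeasure₂_pseudoIso_span_eq ∧
        thmII64_katzMeasure₂_functionalEquation)
    (stub_anacongOfFullDescentDatum : thm222_anacong_goodLattice_of_fullDescentDatum)
    (stub_publishedFactsGreenberg :
      prop411_selmer_isAlmostDivisible ∧
        Literature.NumberTheory.IwasawaTheory.weakLeopoldt_H2_subsingleton_cyclotomic_of_isOpen ∧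
        (∀ (L : Type) [Field L] [NumberField L], Literature.NumberTheory.GaloisCohomology.tateGlobalEulerPoincareCharacteristic L) ∧
        (∀ (L : Type) [Field L] [NumberField L], Literature.NumberTheory.GaloisCohomology.poitouTate_restricted_three_le L))
    (stub_publishedFactsMore :
      prop263_sur_of_crk ∧ thm222_anacong_goodLattice_of_five_le ∧ thm212_exists_isKatzLFunction) :
    Summit.BirchSwinnertonDyer.BirchSwinnertonDyer.Theses.EisensteinPrimes.GoodLatticeBDPValue := by
  -- (T4) from its cyclotomic case (w2 gen 7, p665558)
  have hT4 : weakLeopoldt_H2_subsingleton_above_cyclotomic_of_isOpen :=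
    GoodLatticeBDPValueT4OfCyclotomic.above_cyclotomic_of_cyclotomic stub_publishedFactsGreenberg.2.1
  -- v22's eight Greenberg-type conjuncts (w2 gen 6, p660402; BCGKPST §3.3 from Thm. 3.3.1, w6 gen 2, p661944)
  obtain ⟨h411, h422, h5A, h41, h42, h32, h33, -⟩ :=
    GoodLatticeBDPValuePublishedFactsOfTextbook.publishedFactsGreenberg_of_textbook stub_publishedFactsGreenberg.1
      stub_publishedFactsGreenberg.2.2.1 stub_publishedFactsGreenberg.2.2.2
      (GoodLatticeBDPValueSec33OfThm331.sec33_of_thm331 stub_publishedFacts.2.2.1) hT4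
  -- [AN] at every odd `p`: 3a-A (BY NAME; the `def` unfolds to the registered text) at the datum of the CLOSED 3a-B, and the `5 ≤ p` slice
  have han : thm222_anacong_goodLattice_OPEN :=
    GoodLatticeBDPValueAnThreeBookkeeping.thm222_OPEN_of_fullDescentDatum_of_five_le stub_anacongOfFullDescentDatum
      stub_publishedFactsMore.2.1
  exact GoodLatticeBDPValueOfKatzUnit.goodLatticeBDPValue_of_print_of_leTD_of_le_of_anQ_of_katzUnit
    stub_publishedFacts.1 stub_publishedFacts.2.1 stub_publishedFacts.2.2.1 stub_publishedFacts.2.2.2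
    (GoodLatticeBDPValueKatzUnitSuppliers.katzUnitAll_of_anacong han stub_publishedFactsMore.2.2)
    h411 h422 h5A h41 h42 h32 h33 hT4
    (imprimLambdaLE_of_facts stub_publishedFactsMore.1 stub_publishedFactsGreenberg.2.2.1
      stub_publishedFactsGreenberg.2.2.2 h411 h422 h5A h41 h42 h32 h33 hT4)
    (prop125_imprimitive_of_quotient
      (prop125_quotient_of_corank (prop125_corank_of_ge
        (AcTwistDeformation.prop125_residualPair_unrSelmer_corank_ge_of_facts stub_publishedFactsMore.1 h41 h42 h5A h32))))
    FSideCorankLe.stub_fSideCorankLe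
    (GoodLatticeBDPValueOfNamedFactsSix.anQ_of_thm222_OPEN stub_publishedFacts.2.2.2 han stub_publishedFactsMore.2.2)

end Summit.BirchSwinnertonDyer.BirchSwinnertonDyer.Theorems.GoodLatticeBDPValueOfNamedFactsV25
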